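import Summits.BirchSwinnertonDyer.Rank1Residual.Additive.XGordRankZeroCyclotomicThreeLower
import Summits.BirchSwinnertonDyer.Rank1Residual.Additive.XGordRankZeroOneCyclotomicThreeLower
import Summits.BirchSwinnertonDyer.Rank1Residual.Additive.X3RankZeroCyclotomicThreeFacts
import Summits.BirchSwinnertonDyer.Rank1Residual.Additive.XGordRankZeroOneCyclotomicThreeFacts
import Summits.BirchSwinnertonDyer.Rank1Residual.Additive.GordRankZeroChiBranch
import Summits.BirchSwinnertonDyer.Rank1Residual.Additive.TypeGThree
import HarnessLib

/-!
# The X3 forms of the `K`-side LOWER twins at `p = 3` (lines V14 / V17 reversed): reducible `V[3]`,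
# Wuthrich 2014 Thm. 16 for the torsion clause; ranks `(0,0)` and `(0,1)`; the twist transport
# `BSD(W,3) ↔ BSD(V,3)` between an X3♯(G-ord)@3 pair and its good ordinary EISENSTEIN twist pair
# (cell `b2b-bsdres`, team n1011, seat p16, OWNERS row T-N11-GK3LOW)

HONEST FRAMING (cell `b2b-bsdres`, run/shared/lean/b2b/bsd-rank1-residual/, verbatim in every
file): the goal of the cell is to DELETE the COMBINATION-SHAPED residual classes of the
Birch–Swinnerton-Dyer formula for ALL analytic-rank `≤ 1` elliptic curves over `ℚ` — "full BSD
formula for every rank `≤ 1` curve in class `C`" assembled STRICTLY from published theorems — so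
that the rank-`≤ 1` remainder becomes exactly the CONSTRUCTION-SHAPED classes, which are TYPED
(missing-input `Prop`s), NOT attempted. This is not "finishing BSD". Team n1011 (N10 / N11), seat
p16: research route; the labels of X3 / X1 and the N10 marks are UNCHANGED; nothing is booked here.

Theorems only (no `def`, no `sorry`, no new named fact). X3 companion of
`XGordRankZeroCyclotomicThreeLowerFacts.lean` / `XGordRankZeroOneCyclotomicThreeLowerFacts.lean`: the core
theorems `XGordCyclotomicThreeLower.exists_padicVal_shaAn_add_le` (ranks `(0,0)`) and
`XGordRankZeroOneCyclotomicThreeLower.exists_padicVal_shaAn_add_le` (ranks `(0,1)`) use NOTHING about the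
residual image of `V[3]`, so on the X3 side (`W[3]`, hence `V[3]`, REDUCIBLE — X3♯(G-ord) at `p = 3`,
Kodaira `I₀*`) the torsion clause comes from **Wuthrich 2014 Thm. 16 over `ℚ(ζ₃)`** (named fact
`Wuthrich2014.charIdeal_dvd_padicLFunction_cyclotomicThree`, (A)-part) instead of Kato, as in
additive-p4's X3 lines V14 / V17. The other inputs (Greenberg Thm. 4.1 / p. 110 over `K`, Perrin-Riou,
Mazur–Tate, Milne, modularity, GZK) are the same named facts; the ONE residual input, the section
hypothesis `hLowK` of every theorem, is (⊇/K): every `g ∈ char_Λ X(V/K_∞)` is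
`ι h · ϖϖ' · L₃(V,ω⁰,T) · L₃(V,ω¹,T)`, `h ∈ Λ` — the two-branch main-conjecture CONTAINMENT for `V` over
`K = ℚ(ζ₃)` (PLAN §1.2 II.3's wall at `p = 3`; on the reducible side its `χ_K`-branch is seat p12's
Greenberg–Vatsal-on-the-branch `X3BranchLambdaEq`, its trivial branch the Eisenstein main conjecture of
the X1 pair `(V,3)`; NOT in print as stated; no `def`, no fact).

Results, ranks `(0,0)` (`X3CyclotomicThreeLower.…_of_facts`) and `(0,1)`
(`X3GordRankZeroOneCyclotomicThreeLower.…_of_facts`, certificate `[T¹]L₃ ≠ 0`): the LOWER sum inequality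
(anomalous rows included), the EQUALITY of sums with V14 / V17, `Typed.MissingLowerBoundAt W 3` ⟸ (⊇/K)
+ the UPPER half of the twist, and **`BSDp W 3 ↔ BSDp V 3`** — the X3♯(G-ord)@3 pair closes iff the good
ordinary anomalous EISENSTEIN pair of its twist (an X1 / N1 row, or a covered row) closes, under the
two-sided main conjecture over `K`; class forms `ClassX3Gord.missingLowerBoundAt_three_rankZero[_twistRankOne]_of_lowerK`.
No `BSD(V,3)` theorem exists in the tree for the reducible twist in general (classes X1a/X1b), hence
no unconditional-modulo-(⊇/K) `BSD(W,3)` here, unlike the X4 files. Labels unchanged; nothing booked.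
-/

noncomputable section

open scoped Classical MatrixGroups ModularForm

open CongruenceSubgroup WeierstrassCurve NumberField IsDedekindDomain
  Literature.NumberTheory.EllipticCurves Literature.NumberTheory.EllipticCurves.ModularForms
  Literature.NumberTheory.EllipticCurves.Rank1Residual
  Literature.NumberTheory.EllipticCurves.Rank1Residual.Typed
  Literature.NumberTheory.GaloisRepresentations

namespace Summit.BirchSwinnertonDyer.Rank1Residual.Additive

section Facts

variable (V : WeierstrassCurve ℚ) [V.IsElliptic] [V.IsGloballyMinimal]
  (W : WeierstrassCurve ℚ) [W.IsElliptic] [W.IsGloballyMinimal]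

/- The ONE residual input (⊇/K) for `V` over `K = CyclotomicField 3 ℚ`; shared section hypothesis. -/
variable
    (hLowK : ∀ {κ : ZpExtension (CyclotomicField 3 ℚ) 3}
      {γ : Field.absoluteGaloisGroup (CyclotomicField 3 ℚ)} {N : ℕ} [NeZero N]
      {f : CuspForm (Gamma0 N) 2},
      κ.IsCyclotomic → κ.IsTopGenerator γ →
      (∃ ζ : ℤ_[3]ˣ, IsOfFinOrder ζ ∧
        ((GaloisRep.cyclotomicCharacter (CyclotomicField 3 ℚ) 3 γ * ζ : ℤ_[3]ˣ) : ℤ_[3]) =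
          (cyclotomicGenerator 3 : ℤ_[3])) →
      IsNewformOf V f →
      ∀ (D : (V.baseChange (CyclotomicField 3 ℚ)).SelmerDualData κ γ) (ϖ ϖ' : ℚ),
        (ϖ : ℝ) * V.realPeriodRat = plusPeriod f →
        (ϖ' : ℝ) * V.imaginaryPeriodRat = minusPeriod f →
        ∀ g ∈ D.charIdeal, ∃ h : IwasawaAlgebra 3,
          iwasawaToPowerSeries 3 g =
            iwasawaToPowerSeries 3 h *
              (PowerSeries.C ((ϖ : ℚ_[3]) * (ϖ' : ℚ_[3])) *
                (padicLFunction f ((unitRoot V 3 : ℤ_[3]) : ℚ_[3]) *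
                  padicLFunctionMinusBranch f ((unitRoot V 3 : ℤ_[3]) : ℚ_[3]) 1)))

include hLowK

/-- **X3, ranks `(0,0)`: the LOWER sum inequality from named facts + (⊇/K)** (`V` good ordinary at `3`,
`V[3]` REDUCIBLE, `W = C • V^{(−3)}` ADDITIVE at `3`, both of analytic rank `0`; anomalous rows included).
[cite: Wuthrich2014, Thm. 16 (p. 397)] [cite: GreenbergLNM1716, Thm. 4.1 (p. 102)] [cite: Milne1972ArithmeticAV, §1 Thm. 1] -/
theorem X3CyclotomicThreeLower.exists_padicVal_shaAn_add_le_of_facts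
    (hW16 : Wuthrich2014.charIdeal_dvd_padicLFunction_cyclotomicThree)
    (hGr : Greenberg1999.thm41_charValue_rankZero_numberField)
    (hMilne : Milne1972.bsdQuotient_baseChange_quadratic_anyModel)
    (hGZK : rank_eq_analyticRank_of_analyticRank_le_one) (hmod : hasEntireLFunction_rat)
    (hmodD : nonempty_modularParametrizationData)
    (C : VariableChange ℚ) (hC : C • V.quadraticTwist (-(3 : ℚ)) = W)
    (hord : IsOrdinaryAt V 3) (hred : ¬ V.HasIrreducibleModPGaloisRep 3) (hadd : Addv W 3)
    (hrV : V.analyticRank = 0) (hrW : W.analyticRank = 0) :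
    ∃ qV qW : ℚ, shaAn V = (qV : ℂ) ∧ shaAn W = (qW : ℂ) ∧
      padicValRat 3 qV + padicValRat 3 qW ≤ (padicValNat 3 V.shaOrder : ℤ) + padicValNat 3 W.shaOrder := by
  haveI : IsCyclotomicExtension {3} ℚ (CyclotomicField 3 ℚ) := CyclotomicField.isCyclotomicExtension 3 ℚ
  haveI : NeZero (V.conductorNorm ℤ) := ⟨(V.conductorNorm_pos_holds).ne'⟩
  obtain ⟨Dm⟩ := hmodD V
  have hf : IsNewformOf V Dm.f := Dm.isNewformOf
  obtain ⟨ϖ, -, hϖ, -⟩ := Dm.exists_rat_mul_realPeriodRat_eq_plusPeriod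
  obtain ⟨ϖ', -, hϖ'⟩ := exists_rat_mul_imaginaryPeriodRat_eq_minusPeriod Dm
  haveI : (V.baseChange (CyclotomicField 3 ℚ)).IsElliptic := by rw [baseChange]; infer_instance
  refine XGordCyclotomicThreeLower.exists_padicVal_shaAn_add_le (CyclotomicField 3 ℚ) V W hGZK hmod
    hMilne C hC hord hadd hrV hrW hf ϖ ϖ' hϖ hϖ'
    (exists_isCyclotomic_isTopGenerator_cyclotomicThree (CyclotomicField 3 ℚ))
    (fun κ γ hκ hγ hγ' D ↦ ?_) (fun κ γ hκ hγ hγ' D g hg ↦ hLowK hκ hγ hγ' hf D ϖ ϖ' hϖ hϖ' g hg)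
    (X3CyclotomicThree.greenbergK_of_fact (CyclotomicField 3 ℚ) V hGr hord)
    (constantCoeff_padicLFunctionMinusBranch_one_three V hord hf)
  exact (hW16 V (CyclotomicField 3 ℚ) (V.baseChange (CyclotomicField 3 ℚ)) hord hred
    ⟨1, one_smul _ _⟩ hκ hγ hγ' hf D ϖ ϖ' hϖ hϖ').1

/-- **X3, ranks `(0,0)`: EQUALITY of sums under the two-sided main conjecture over `K`** (V14 ⊆ + ⊇/K).
[cite: Wuthrich2014, Thm. 16 (p. 397)] [cite: GreenbergLNM1716, Thm. 4.1 (p. 102)] -/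
theorem X3CyclotomicThreeLower.padicVal_shaOrder_add_eq_of_facts
    (hW16 : Wuthrich2014.charIdeal_dvd_padicLFunction_cyclotomicThree)
    (hGr : Greenberg1999.thm41_charValue_rankZero_numberField)
    (hMilne : Milne1972.bsdQuotient_baseChange_quadratic_anyModel)
    (hGZK : rank_eq_analyticRank_of_analyticRank_le_one) (hmod : hasEntireLFunction_rat)
    (hmodD : nonempty_modularParametrizationData)
    (C : VariableChange ℚ) (hC : C • V.quadraticTwist (-(3 : ℚ)) = W)
    (hord : IsOrdinaryAt V 3) (hred : ¬ V.HasIrreducibleModPGaloisRep 3) (hadd : Addv W 3)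
    (hrV : V.analyticRank = 0) (hrW : W.analyticRank = 0) :
    ∃ qV qW : ℚ, shaAn V = (qV : ℂ) ∧ shaAn W = (qW : ℂ) ∧
      (padicValNat 3 V.shaOrder : ℤ) + padicValNat 3 W.shaOrder = padicValRat 3 qV + padicValRat 3 qW := by
  obtain ⟨qV, qW, hqV, hqW, hle⟩ := X3CyclotomicThree.exists_padicVal_shaOrder_add_le_of_facts V W hW16 hGr
    hMilne hGZK hmod hmodD C hC hord hred hadd hrV hrW
  obtain ⟨qV', qW', hqV', hqW', hge⟩ :=
    X3CyclotomicThreeLower.exists_padicVal_shaAn_add_le_of_facts V W hLowK hW16 hGr hMilne hGZK hmod hmodD C hC hord hred hadd hrV hrW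
  have hqq : qV' = qV := by exact_mod_cast hqV'.symm.trans hqV
  have hqq' : qW' = qW := by exact_mod_cast hqW'.symm.trans hqW
  subst hqq hqq'
  exact ⟨qV', qW', hqV, hqW, le_antisymm hle hge⟩

/-- **X3, ranks `(0,0)`: `Typed.MissingLowerBoundAt W 3` ⟸ (⊇/K) + the UPPER half of the twist `V`.**
[cite: GreenbergLNM1716, Thm. 4.1 (p. 102)] [cite: Miller2011LMS, Def. 1.1] -/
theorem X3CyclotomicThreeLower.missingLowerBoundAt_of_missingUpperBoundAt_twist_of_facts
    (hW16 : Wuthrich2014.charIdeal_dvd_padicLFunction_cyclotomicThree)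
    (hGr : Greenberg1999.thm41_charValue_rankZero_numberField)
    (hMilne : Milne1972.bsdQuotient_baseChange_quadratic_anyModel)
    (hGZK : rank_eq_analyticRank_of_analyticRank_le_one) (hmod : hasEntireLFunction_rat)
    (hmodD : nonempty_modularParametrizationData)
    (C : VariableChange ℚ) (hC : C • V.quadraticTwist (-(3 : ℚ)) = W)
    (hord : IsOrdinaryAt V 3) (hred : ¬ V.HasIrreducibleModPGaloisRep 3) (hadd : Addv W 3)
    (hrV : V.analyticRank = 0) (hrW : W.analyticRank = 0)
    (huV : MissingUpperBoundAt V 3) : MissingLowerBoundAt W 3 := by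
  obtain ⟨qV, qW, hqV, hqW, hge⟩ :=
    X3CyclotomicThreeLower.exists_padicVal_shaAn_add_le_of_facts V W hLowK hW16 hGr hMilne hGZK hmod hmodD C hC hord hred hadd hrV hrW
  obtain ⟨qV', hqV', hu⟩ := huV
  have hqq : qV' = qV := by exact_mod_cast hqV'.symm.trans hqV
  subst hqq
  exact ⟨qW, hqW, by linarith⟩

/-- **X3, ranks `(0,0)`: `BSD(W,3) ↔ BSD(V,3)` under the two-sided main conjecture over `K = ℚ(ζ₃)`.**
[cite: Wuthrich2014, Thm. 16 (p. 397)] [cite: Miller2011LMS, §1 and Def. 1.1] -/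
theorem X3CyclotomicThreeLower.bsdp_iff_bsdp_twist_of_facts
    (hW16 : Wuthrich2014.charIdeal_dvd_padicLFunction_cyclotomicThree)
    (hGr : Greenberg1999.thm41_charValue_rankZero_numberField)
    (hMilne : Milne1972.bsdQuotient_baseChange_quadratic_anyModel)
    (hGZK : rank_eq_analyticRank_of_analyticRank_le_one) (hmod : hasEntireLFunction_rat)
    (hmodD : nonempty_modularParametrizationData)
    (C : VariableChange ℚ) (hC : C • V.quadraticTwist (-(3 : ℚ)) = W)
    (hord : IsOrdinaryAt V 3) (hred : ¬ V.HasIrreducibleModPGaloisRep 3) (hadd : Addv W 3)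
    (hrV : V.analyticRank = 0) (hrW : W.analyticRank = 0) :
    BSDp W 3 ↔ BSDp V 3 := by
  obtain ⟨qV, qW, hqV, hqW, heq⟩ :=
    X3CyclotomicThreeLower.padicVal_shaOrder_add_eq_of_facts V W hLowK hW16 hGr hMilne hGZK hmod hmodD C hC hord hred hadd hrV hrW
  have hrV1 : V.analyticRank ≤ 1 := by rw [hrV]; exact zero_le_one
  have hrW1 : W.analyticRank ≤ 1 := by rw [hrW]; exact zero_le_one
  haveI : Finite V.sha := (hGZK V hrV1).2
  haveI : Finite W.sha := (hGZK W hrW1).2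
  constructor
  · intro hW
    obtain ⟨qW', hqW', hvW⟩ := missingPPartAt_of_bsdp W 3 hW
    have hqq : qW' = qW := by exact_mod_cast hqW'.symm.trans hqW
    subst hqq
    exact bsdp_of_missingPPartAt V 3 hGZK hrV1 ⟨qV, hqV, by linarith⟩
  · intro hV
    obtain ⟨qV', hqV', hvV⟩ := missingPPartAt_of_bsdp V 3 hV
    have hqq : qV' = qV := by exact_mod_cast hqV'.symm.trans hqV
    subst hqq
    exact bsdp_of_missingPPartAt W 3 hGZK hrW1 ⟨qW, hqW, by linarith⟩

/-- **X3, ranks `(0,1)`: the LOWER sum inequality from named facts + (⊇/K) + the certificate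
`[T¹]L₃(f,α) ≠ 0`** (`V` of analytic rank ONE; Schneider over `ℚ(ζ₃)`, Perrin-Riou, Mazur–Tate as in V17).
[cite: Wuthrich2014, Thm. 16 (p. 397)] [cite: GreenbergLNM1716, §4 p. 110] [cite: PerrinRiou1987, §1.4 Cor. 1.8] -/
theorem X3GordRankZeroOneCyclotomicThreeLower.exists_padicVal_shaAn_add_le_of_facts
    (hW16 : Wuthrich2014.charIdeal_dvd_padicLFunction_cyclotomicThree)
    (hS1 : Greenberg1999.schneider_charCoeff_rankOne_quadraticBaseChange)
    (hPR : perrinRiou_rankOne_leadingTerms_odd) (hMT : mazur_tate_sigma_exists_odd)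
    (hMilne : Milne1972.bsdQuotient_baseChange_quadratic_anyModel)
    (hGZK : rank_eq_analyticRank_of_analyticRank_le_one) (hmod : hasEntireLFunction_rat)
    (hmodD : nonempty_modularParametrizationData)
    (C : VariableChange ℚ) (hC : C • V.quadraticTwist (-(3 : ℚ)) = W)
    (hord : IsOrdinaryAt V 3) (hred : ¬ V.HasIrreducibleModPGaloisRep 3) (hadd : Addv W 3)
    (hrV : V.analyticRank = 1) (hrW : W.analyticRank = 0)
    (hcert : ∀ {N : ℕ} [NeZero N] (f : CuspForm (Gamma0 N) 2), IsNewformOf V f →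
      PowerSeries.coeff 1 (padicLFunction f ((unitRoot V 3 : ℤ_[3]) : ℚ_[3])) ≠ 0) :
    ∃ qV qW : ℚ, shaAn V = (qV : ℂ) ∧ shaAn W = (qW : ℂ) ∧
      padicValRat 3 qV + padicValRat 3 qW ≤ (padicValNat 3 V.shaOrder : ℤ) + padicValNat 3 W.shaOrder := by
  haveI : IsCyclotomicExtension {3} ℚ (CyclotomicField 3 ℚ) := CyclotomicField.isCyclotomicExtension 3 ℚ
  set K := CyclotomicField 3 ℚ
  haveI : NeZero (V.conductorNorm ℤ) := ⟨(V.conductorNorm_pos_holds).ne'⟩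
  obtain ⟨Dm⟩ := hmodD V
  have hf : IsNewformOf V Dm.f := Dm.isNewformOf
  obtain ⟨ϖ, -, hϖ, -⟩ := Dm.exists_rat_mul_realPeriodRat_eq_plusPeriod
  obtain ⟨ϖ', -, hϖ'⟩ := exists_rat_mul_imaginaryPeriodRat_eq_minusPeriod Dm
  obtain ⟨Dh, hDh⟩ := exists_isCanonical_of_odd hMT V 3 (by norm_num) hord.1 hord.2
  haveI : (V.baseChange K).IsElliptic := by rw [baseChange]; infer_instance
  refine XGordRankZeroOneCyclotomicThreeLower.exists_padicVal_shaAn_add_le K V W hPR hGZK hmod hMilne C hC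
    hord hadd hrV hrW hf ϖ ϖ' hϖ hϖ' Dh hDh (hcert Dm.f hf) (fun κ γ hκ hγ hγ' D ↦ ?_)
    (fun κ γ hκ hγ hγ' D g hg ↦ hLowK hκ hγ hγ' hf D ϖ ϖ' hϖ hϖ' g hg)
    (XGordRankZeroOneCyclotomicThree.schneiderK_of_fact K V hS1 hord)
  exact (hW16 V K (V.baseChange K) hord hred ⟨1, one_smul _ _⟩ hκ hγ hγ' hf D ϖ ϖ' hϖ hϖ').1

/-- **X3, ranks `(0,1)`: EQUALITY of sums under the two-sided main conjecture over `K`** (V17 ⊆ + ⊇/K).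
[cite: Wuthrich2014, Thm. 16 (p. 397)] [cite: GreenbergLNM1716, §4 p. 110] -/
theorem X3GordRankZeroOneCyclotomicThreeLower.padicVal_shaOrder_add_eq_of_facts
    (hW16 : Wuthrich2014.charIdeal_dvd_padicLFunction_cyclotomicThree)
    (hS1 : Greenberg1999.schneider_charCoeff_rankOne_quadraticBaseChange)
    (hPR : perrinRiou_rankOne_leadingTerms_odd) (hMT : mazur_tate_sigma_exists_odd)
    (hMilne : Milne1972.bsdQuotient_baseChange_quadratic_anyModel)
    (hGZK : rank_eq_analyticRank_of_analyticRank_le_one) (hmod : hasEntireLFunction_rat)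
    (hmodD : nonempty_modularParametrizationData)
    (C : VariableChange ℚ) (hC : C • V.quadraticTwist (-(3 : ℚ)) = W)
    (hord : IsOrdinaryAt V 3) (hred : ¬ V.HasIrreducibleModPGaloisRep 3) (hadd : Addv W 3)
    (hrV : V.analyticRank = 1) (hrW : W.analyticRank = 0)
    (hcert : ∀ {N : ℕ} [NeZero N] (f : CuspForm (Gamma0 N) 2), IsNewformOf V f →
      PowerSeries.coeff 1 (padicLFunction f ((unitRoot V 3 : ℤ_[3]) : ℚ_[3])) ≠ 0) :
    ∃ qV qW : ℚ, shaAn V = (qV : ℂ) ∧ shaAn W = (qW : ℂ) ∧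
      (padicValNat 3 V.shaOrder : ℤ) + padicValNat 3 W.shaOrder = padicValRat 3 qV + padicValRat 3 qW := by
  obtain ⟨qV, qW, hqV, hqW, hle⟩ :=
    X3GordRankZeroOneCyclotomicThree.exists_padicVal_shaOrder_add_le_of_facts V W hW16 hS1 hPR hMT hMilne
      hGZK hmod hmodD C hC hord hred hadd hrV hrW hcert
  obtain ⟨qV', qW', hqV', hqW', hge⟩ :=
    X3GordRankZeroOneCyclotomicThreeLower.exists_padicVal_shaAn_add_le_of_facts V W hLowK hW16 hS1 hPR hMT hMilne hGZK hmod hmodD C hC hord hred hadd hrV hrW hcert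
  have hqq : qV' = qV := by exact_mod_cast hqV'.symm.trans hqV
  have hqq' : qW' = qW := by exact_mod_cast hqW'.symm.trans hqW
  subst hqq hqq'
  exact ⟨qV', qW', hqV, hqW, le_antisymm hle hge⟩

/-- **X3, ranks `(0,1)`: `Typed.MissingLowerBoundAt W 3` ⟸ (⊇/K) + certificate + the UPPER half of the
rank-one Eisenstein twist `V`.** [cite: GreenbergLNM1716, §4 p. 110] [cite: Miller2011LMS, Def. 1.1] -/
theorem X3GordRankZeroOneCyclotomicThreeLower.missingLowerBoundAt_of_missingUpperBoundAt_twist_of_facts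
    (hW16 : Wuthrich2014.charIdeal_dvd_padicLFunction_cyclotomicThree)
    (hS1 : Greenberg1999.schneider_charCoeff_rankOne_quadraticBaseChange)
    (hPR : perrinRiou_rankOne_leadingTerms_odd) (hMT : mazur_tate_sigma_exists_odd)
    (hMilne : Milne1972.bsdQuotient_baseChange_quadratic_anyModel)
    (hGZK : rank_eq_analyticRank_of_analyticRank_le_one) (hmod : hasEntireLFunction_rat)
    (hmodD : nonempty_modularParametrizationData)
    (C : VariableChange ℚ) (hC : C • V.quadraticTwist (-(3 : ℚ)) = W)
    (hord : IsOrdinaryAt V 3) (hred : ¬ V.HasIrreducibleModPGaloisRep 3) (hadd : Addv W 3)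
    (hrV : V.analyticRank = 1) (hrW : W.analyticRank = 0)
    (hcert : ∀ {N : ℕ} [NeZero N] (f : CuspForm (Gamma0 N) 2), IsNewformOf V f →
      PowerSeries.coeff 1 (padicLFunction f ((unitRoot V 3 : ℤ_[3]) : ℚ_[3])) ≠ 0)
    (huV : MissingUpperBoundAt V 3) : MissingLowerBoundAt W 3 := by
  obtain ⟨qV, qW, hqV, hqW, hge⟩ :=
    X3GordRankZeroOneCyclotomicThreeLower.exists_padicVal_shaAn_add_le_of_facts V W hLowK hW16 hS1 hPR hMT hMilne hGZK hmod hmodD C hC hord hred hadd hrV hrW hcert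
  obtain ⟨qV', hqV', hu⟩ := huV
  have hqq : qV' = qV := by exact_mod_cast hqV'.symm.trans hqV
  subst hqq
  exact ⟨qW, hqW, by linarith⟩

/-- **X3, ranks `(0,1)`: `BSD(W,3) ↔ BSD(V,3)` under the two-sided main conjecture over `K = ℚ(ζ₃)`** (the
twist pair is an X1 `r = 1` row). [cite: Wuthrich2014, Thm. 16 (p. 397)] [cite: Miller2011LMS, §1 and Def. 1.1] -/
theorem X3GordRankZeroOneCyclotomicThreeLower.bsdp_iff_bsdp_twist_of_facts
    (hW16 : Wuthrich2014.charIdeal_dvd_padicLFunction_cyclotomicThree)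
    (hS1 : Greenberg1999.schneider_charCoeff_rankOne_quadraticBaseChange)
    (hPR : perrinRiou_rankOne_leadingTerms_odd) (hMT : mazur_tate_sigma_exists_odd)
    (hMilne : Milne1972.bsdQuotient_baseChange_quadratic_anyModel)
    (hGZK : rank_eq_analyticRank_of_analyticRank_le_one) (hmod : hasEntireLFunction_rat)
    (hmodD : nonempty_modularParametrizationData)
    (C : VariableChange ℚ) (hC : C • V.quadraticTwist (-(3 : ℚ)) = W)
    (hord : IsOrdinaryAt V 3) (hred : ¬ V.HasIrreducibleModPGaloisRep 3) (hadd : Addv W 3)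
    (hrV : V.analyticRank = 1) (hrW : W.analyticRank = 0)
    (hcert : ∀ {N : ℕ} [NeZero N] (f : CuspForm (Gamma0 N) 2), IsNewformOf V f →
      PowerSeries.coeff 1 (padicLFunction f ((unitRoot V 3 : ℤ_[3]) : ℚ_[3])) ≠ 0) :
    BSDp W 3 ↔ BSDp V 3 := by
  obtain ⟨qV, qW, hqV, hqW, heq⟩ :=
    X3GordRankZeroOneCyclotomicThreeLower.padicVal_shaOrder_add_eq_of_facts V W hLowK hW16 hS1 hPR hMT hMilne hGZK hmod hmodD C hC hord hred hadd hrV hrW hcert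
  have hrV1 : V.analyticRank ≤ 1 := by rw [hrV]
  have hrW1 : W.analyticRank ≤ 1 := by rw [hrW]; exact zero_le_one
  haveI : Finite V.sha := (hGZK V hrV1).2
  haveI : Finite W.sha := (hGZK W hrW1).2
  constructor
  · intro hW
    obtain ⟨qW', hqW', hvW⟩ := missingPPartAt_of_bsdp W 3 hW
    have hqq : qW' = qW := by exact_mod_cast hqW'.symm.trans hqW
    subst hqq
    exact bsdp_of_missingPPartAt V 3 hGZK hrV1 ⟨qV, hqV, by linarith⟩
  · intro hV
    obtain ⟨qV', hqV', hvV⟩ := missingPPartAt_of_bsdp V 3 hV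
    have hqq : qV' = qV := by exact_mod_cast hqV'.symm.trans hqV
    subst hqq
    exact bsdp_of_missingPPartAt W 3 hGZK hrW1 ⟨qW, hqW, by linarith⟩

end Facts

/-! ## Class forms on X3♯(G-ord)@3 rows (`ClassX3Gord W 3`) -/

section ClassForms

variable {W : WeierstrassCurve ℚ} [W.IsElliptic] [W.IsGloballyMinimal]

variable
    (hLowK : ∀ (V : WeierstrassCurve ℚ) [V.IsElliptic] [V.IsGloballyMinimal] (C : VariableChange ℚ),
      GoodOrd V 3 → C • V.quadraticTwist (-(3 : ℚ)) = W →
      ∀ {κ : ZpExtension (CyclotomicField 3 ℚ) 3}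
      {γ : Field.absoluteGaloisGroup (CyclotomicField 3 ℚ)} {N : ℕ} [NeZero N]
      {f : CuspForm (Gamma0 N) 2},
      κ.IsCyclotomic → κ.IsTopGenerator γ →
      (∃ ζ : ℤ_[3]ˣ, IsOfFinOrder ζ ∧
        ((GaloisRep.cyclotomicCharacter (CyclotomicField 3 ℚ) 3 γ * ζ : ℤ_[3]ˣ) : ℤ_[3]) =
          (cyclotomicGenerator 3 : ℤ_[3])) →
      IsNewformOf V f →
      ∀ (D : (V.baseChange (CyclotomicField 3 ℚ)).SelmerDualData κ γ) (ϖ ϖ' : ℚ),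
        (ϖ : ℝ) * V.realPeriodRat = plusPeriod f →
        (ϖ' : ℝ) * V.imaginaryPeriodRat = minusPeriod f →
        ∀ g ∈ D.charIdeal, ∃ h : IwasawaAlgebra 3,
          iwasawaToPowerSeries 3 g =
            iwasawaToPowerSeries 3 h *
              (PowerSeries.C ((ϖ : ℚ_[3]) * (ϖ' : ℚ_[3])) *
                (padicLFunction f ((unitRoot V 3 : ℤ_[3]) : ℚ_[3]) *
                  padicLFunctionMinusBranch f ((unitRoot V 3 : ℤ_[3]) : ℚ_[3]) 1)))

include hLowK

/-- **X3♯(G-ord) at `3`, `r_an(E) = 0`, twist of analytic rank `0`, EVERY ROW (anomalous included): the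
LOWER half `ord₃ #Ш_an(E) ≤ ord₃ #Ш(E)` ⟸ (⊇/K) for the good ordinary (Eisenstein) twist models of
`E^{(−3)}` + their UPPER halves** (per-row binders incl. `hred`; twist model by
`ClassX3Gord.exists_goodOrd_pStar_twist_model`). [cite: Wuthrich2014, Thm. 16 (p. 397)] -/
theorem ClassX3Gord.missingLowerBoundAt_three_rankZero_of_lowerK [Fact (Nat.Prime 3)]
    (hW16 : Wuthrich2014.charIdeal_dvd_padicLFunction_cyclotomicThree)
    (hGr : Greenberg1999.thm41_charValue_rankZero_numberField)
    (hMilne : Milne1972.bsdQuotient_baseChange_quadratic_anyModel)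
    (hGZK : rank_eq_analyticRank_of_analyticRank_le_one) (hmod : hasEntireLFunction_rat)
    (hmodD : nonempty_modularParametrizationData)
    (hX : ClassX3Gord W 3) (hr : W.analyticRank = 0)
    (hred : ∀ (V : WeierstrassCurve ℚ) [V.IsElliptic] [V.IsGloballyMinimal] (C : VariableChange ℚ),
      GoodOrd V 3 → C • V.quadraticTwist (-(3 : ℚ)) = W → ¬ V.HasIrreducibleModPGaloisRep 3)
    (hrV : ∀ (V : WeierstrassCurve ℚ) [V.IsElliptic] [V.IsGloballyMinimal] (C : VariableChange ℚ),
      GoodOrd V 3 → C • V.quadraticTwist (-(3 : ℚ)) = W → V.analyticRank = 0)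
    (huV : ∀ (V : WeierstrassCurve ℚ) [V.IsElliptic] [V.IsGloballyMinimal] (C : VariableChange ℚ),
      GoodOrd V 3 → C • V.quadraticTwist (-(3 : ℚ)) = W → MissingUpperBoundAt V 3) :
    MissingLowerBoundAt W 3 := by
  obtain ⟨V, iV, iVm, C, hgo, hC⟩ := ClassX3Gord.exists_goodOrd_pStar_twist_model W 3 (by norm_num) hX
    (semistabilityIndex_eq_two_of_typeG_three W hX.typeGOrd.typeG hX.addv)
  have hC' : C • V.quadraticTwist (-(3 : ℚ)) = W := by
    have h3 : ((-1 : ℚ) ^ ((3 : ℕ) / 2) * (3 : ℕ)) = -(3 : ℚ) := by norm_num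
    rw [← h3]; exact hC
  exact X3CyclotomicThreeLower.missingLowerBoundAt_of_missingUpperBoundAt_twist_of_facts V W
    (fun hκ hγ hγ' hf D ϖ ϖ' hϖ hϖ' g hg ↦ hLowK V C hgo hC' hκ hγ hγ' hf D ϖ ϖ' hϖ hϖ' g hg)
    hW16 hGr hMilne hGZK hmod hmodD C hC' hgo (hred V C hgo hC') hX.addv (hrV V C hgo hC') hr
    (huV V C hgo hC')

/-- **X3♯(G-ord) at `3`, `r_an(E) = 0`, twist of analytic rank ONE, EVERY ROW (anomalous included): the
LOWER half ⟸ (⊇/K) for the good ordinary (Eisenstein) twist models of `E^{(−3)}` + their certificates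
`[T¹]L₃ ≠ 0` + their UPPER halves.** [cite: Wuthrich2014, Thm. 16 (p. 397)] [cite: GreenbergLNM1716, §4 p. 110] -/
theorem ClassX3Gord.missingLowerBoundAt_three_rankZero_twistRankOne_of_lowerK [Fact (Nat.Prime 3)]
    (hW16 : Wuthrich2014.charIdeal_dvd_padicLFunction_cyclotomicThree)
    (hS1 : Greenberg1999.schneider_charCoeff_rankOne_quadraticBaseChange)
    (hPR : perrinRiou_rankOne_leadingTerms_odd) (hMT : mazur_tate_sigma_exists_odd)
    (hMilne : Milne1972.bsdQuotient_baseChange_quadratic_anyModel)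
    (hGZK : rank_eq_analyticRank_of_analyticRank_le_one) (hmod : hasEntireLFunction_rat)
    (hmodD : nonempty_modularParametrizationData)
    (hX : ClassX3Gord W 3) (hr : W.analyticRank = 0)
    (hred : ∀ (V : WeierstrassCurve ℚ) [V.IsElliptic] [V.IsGloballyMinimal] (C : VariableChange ℚ),
      GoodOrd V 3 → C • V.quadraticTwist (-(3 : ℚ)) = W → ¬ V.HasIrreducibleModPGaloisRep 3)
    (hrV : ∀ (V : WeierstrassCurve ℚ) [V.IsElliptic] [V.IsGloballyMinimal] (C : VariableChange ℚ),
      GoodOrd V 3 → C • V.quadraticTwist (-(3 : ℚ)) = W → V.analyticRank = 1)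
    (hcert : ∀ (V : WeierstrassCurve ℚ) [V.IsElliptic] [V.IsGloballyMinimal] (C : VariableChange ℚ),
      GoodOrd V 3 → C • V.quadraticTwist (-(3 : ℚ)) = W →
      ∀ {N : ℕ} [NeZero N] (f : CuspForm (Gamma0 N) 2), IsNewformOf V f →
      PowerSeries.coeff 1 (padicLFunction f ((unitRoot V 3 : ℤ_[3]) : ℚ_[3])) ≠ 0)
    (huV : ∀ (V : WeierstrassCurve ℚ) [V.IsElliptic] [V.IsGloballyMinimal] (C : VariableChange ℚ),
      GoodOrd V 3 → C • V.quadraticTwist (-(3 : ℚ)) = W → MissingUpperBoundAt V 3) :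
    MissingLowerBoundAt W 3 := by
  obtain ⟨V, iV, iVm, C, hgo, hC⟩ := ClassX3Gord.exists_goodOrd_pStar_twist_model W 3 (by norm_num) hX
    (semistabilityIndex_eq_two_of_typeG_three W hX.typeGOrd.typeG hX.addv)
  have hC' : C • V.quadraticTwist (-(3 : ℚ)) = W := by
    have h3 : ((-1 : ℚ) ^ ((3 : ℕ) / 2) * (3 : ℕ)) = -(3 : ℚ) := by norm_num
    rw [← h3]; exact hC
  exact X3GordRankZeroOneCyclotomicThreeLower.missingLowerBoundAt_of_missingUpperBoundAt_twist_of_facts V W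
    (fun hκ hγ hγ' hf D ϖ ϖ' hϖ hϖ' g hg ↦ hLowK V C hgo hC' hκ hγ hγ' hf D ϖ ϖ' hϖ hϖ' g hg)
    hW16 hS1 hPR hMT hMilne hGZK hmod hmodD C hC' hgo (hred V C hgo hC') hX.addv (hrV V C hgo hC') hr
    (hcert V C hgo hC') (huV V C hgo hC')

end ClassForms

end Summit.BirchSwinnertonDyer.Rank1Residual.Additive

end
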